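/-
Lead `ym-line-cbag-p2` (prover-ym-line-cbag-p2-g2-0), crux `BulkAllGroups` (stmt-QuantumFields-22255), line `dlr-chessboard-G`:
STATEMENT FILE for the p1 work package (PLAN v6) — the eventually-in-β bookkeeping facts consumed VERBATIM by the two stub assemblers
`…StubKernelCovExpansionG` / `…StubKernelMeanExpansionG` (lead p2).  p1: prove this theorem (same name, same statement) in
`Theorems/ColdBoxAllGroupsBulkAllGroupsKernelDatumBoundsG.lean` (split helper monomial files as you like); `sorry` here only.
-/
import Summits.QuantumFields.YangMills.Theorems.ColdBoxAllGroupsBulkAllGroupsKernelCovDatumCoreG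

/-!
# Statement: `eventually_kernelDatum_boundsG` (exponent bookkeeping of the datum one-scale expansion, both stubs)

Parameters: `0 < θ ≤ 1/200`, `δ = θ/5`, `A = θ/20`, `ε = 6θ`, `H = ⌈β^θ⌉`, `T = ⌈β^A⌉`; constants: `N` (degree), `D = dimE ρ`, `Ca, CE > 0`
(datum package `exists_datum_packageG_datVec`), `r₂, C₂ > 0` (Helgason Jacobian, `exists_chartMeasureE_restrict_closedBall_eq_withDensity`),
`η₀ > 0` (`linkWindow_subset_image_expChart`).  Quantities (all written out below): exterior radius `r = Ca β^(3θ+δ−1/2)`; link window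
`L = (12H²+2H+1)(√2·√(β^(2ε−1)) + 8r)`, chart ball `m = 2L`; energy `B = CE(2H+3)⁴β^(2δ−1)`; scaled background bound
`R' = √β·√B + 4(√β·r)`; Gaussian radius `R = β^ε/(4(√D+1))`; Gaussian link radius `mE = √D(12H²+2H+1)((R+R') + 4√β r)/√β`;
`P = 240D(2H+1)⁴e^(−R²/2)`; `pY = e^(−β^ε)`; `ℓ = 2C₂m²`, `τ = 190βm³`, `w = 120(2H+1)⁴τ + 4(2H+1)⁴ℓ`; `M = β^(2ε)`, `K₁ = 2D(R'²+2)`,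
`K₂ = 3D²(R'⁴+11)`.  Worst exponent: `M²·w ~ β^(52θ−1/2)` vs target `β^(−θ/2)`.  Tree tools: `…WeakCouplingRatesEventuallyPow`
(`exists_const_mul_boxSide_pow_mul_rpow_le`, `exists_const_mul_rpow_mul_exp_neg_le`, …), flat `…ExponentsGPrelims/ExponentsG`.
No claim about the mass gap.
-/

set_option autoImplicit false

noncomputable section

open Filter Topology

namespace Summit.QuantumFields.YangMills.Theorems.ColdBoxAllGroups

/-- **Eventually-in-`β` bookkeeping of the datum one-scale expansion** (both stubs of crux `BulkAllGroups`).  STATEMENT ONLY (p1 proves). -/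
theorem eventually_kernelDatum_boundsG (N D : ℕ) {Ca CE r₂ C₂ η₀ θ : ℝ} (hCa : 0 < Ca) (hCE : 0 < CE) (hr₂ : 0 < r₂) (hC₂ : 0 < C₂)
    (hη₀ : 0 < η₀) (hθ : 0 < θ) (hθ2 : θ ≤ 1 / 200) :
    ∀ᶠ β : ℝ in atTop, 1 ≤ β ∧ 8 * ⌈β ^ (θ / 20)⌉₊ ≤ ⌈β ^ θ⌉₊ ∧
      -- (1) link window below the local-surjectivity radius; chart ball radius m = 2L ≤ 1/4 and ≤ r₂ (Jacobian ball)
      ((12 * (⌈β ^ θ⌉₊ : ℝ) ^ 2 + 2 * (⌈β ^ θ⌉₊ : ℝ) + 1) * (Real.sqrt 2 * Real.sqrt (β ^ (2 * (6 * θ) - 1)) + 8 * (Ca * β ^ (3 * θ + θ / 5 - 1 / 2)))) ≤ η₀ ∧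
      (2 * ((12 * (⌈β ^ θ⌉₊ : ℝ) ^ 2 + 2 * (⌈β ^ θ⌉₊ : ℝ) + 1) * (Real.sqrt 2 * Real.sqrt (β ^ (2 * (6 * θ) - 1)) + 8 * (Ca * β ^ (3 * θ + θ / 5 - 1 / 2))))) ≤ 1 / 4 ∧
      (2 * ((12 * (⌈β ^ θ⌉₊ : ℝ) ^ 2 + 2 * (⌈β ^ θ⌉₊ : ℝ) + 1) * (Real.sqrt 2 * Real.sqrt (β ^ (2 * (6 * θ) - 1)) + 8 * (Ca * β ^ (3 * θ + θ / 5 - 1 / 2))))) ≤ r₂ ∧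
      -- (2) Gaussian link radius mE ≤ m and the goodTDE sandwich window
      (Real.sqrt D * ((12 * (⌈β ^ θ⌉₊ : ℝ) ^ 2 + 2 * (⌈β ^ θ⌉₊ : ℝ) + 1) * (((β ^ (6 * θ) / (4 * (Real.sqrt D + 1))) + (Real.sqrt β * Real.sqrt (CE * (2 * (⌈β ^ θ⌉₊ : ℝ) + 3) ^ 4 * β ^ (2 * (θ / 5) - 1)) + 4 * (Real.sqrt β * (Ca * β ^ (3 * θ + θ / 5 - 1 / 2))))) + 4 * (Real.sqrt β * (Ca * β ^ (3 * θ + θ / 5 - 1 / 2))))) / Real.sqrt β) ≤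
        (2 * ((12 * (⌈β ^ θ⌉₊ : ℝ) ^ 2 + 2 * (⌈β ^ θ⌉₊ : ℝ) + 1) * (Real.sqrt 2 * Real.sqrt (β ^ (2 * (6 * θ) - 1)) + 8 * (Ca * β ^ (3 * θ + θ / 5 - 1 / 2))))) ∧
      (D : ℝ) / 2 * ((β ^ (6 * θ) / (4 * (Real.sqrt D + 1))) + (Real.sqrt β * Real.sqrt (CE * (2 * (⌈β ^ θ⌉₊ : ℝ) + 3) ^ 4 * β ^ (2 * (θ / 5) - 1)) + 4 * (Real.sqrt β * (Ca * β ^ (3 * θ + θ / 5 - 1 / 2))))) ^ 2 / β + 190 * (2 * ((12 * (⌈β ^ θ⌉₊ : ℝ) ^ 2 + 2 * (⌈β ^ θ⌉₊ : ℝ) + 1) * (Real.sqrt 2 * Real.sqrt (β ^ (2 * (6 * θ) - 1)) + 8 * (Ca * β ^ (3 * θ + θ / 5 - 1 / 2))))) ^ 3 < β ^ (2 * (6 * θ) - 1) ∧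
      -- (3) Gaussian bad mass P ≤ 1/2
      (240 * (D : ℝ) * (2 * (⌈β ^ θ⌉₊ : ℝ) + 1) ^ 4 * Real.exp (-(β ^ (6 * θ) / (4 * (Real.sqrt D + 1))) ^ 2 / 2)) ≤ 1 / 2 ∧
      -- (4) the covariance core's bound is ≤ β^(-θ/2)
      6 * (2 * N * β) * (2 * N * β) * Real.exp (-(β ^ (6 * θ))) +
        (3 * (β ^ (2 * (6 * θ))) ^ 2 * (Real.exp (2 * (120 * (2 * (⌈β ^ θ⌉₊ : ℝ) + 1) ^ 4 * (190 * β * (2 * ((12 * (⌈β ^ θ⌉₊ : ℝ) ^ 2 + 2 * (⌈β ^ θ⌉₊ : ℝ) + 1) * (Real.sqrt 2 * Real.sqrt (β ^ (2 * (6 * θ) - 1)) + 8 * (Ca * β ^ (3 * θ + θ / 5 - 1 / 2))))) ^ 3) + 4 * (2 * (⌈β ^ θ⌉₊ : ℝ) + 1) ^ 4 * (2 * C₂ * (2 * ((12 * (⌈β ^ θ⌉₊ : ℝ) ^ 2 + 2 * (⌈β ^ θ⌉₊ : ℝ) + 1) * (Real.sqrt 2 * Real.sqrt (β ^ (2 *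 (6 * θ) - 1)) + 8 * (Ca * β ^ (3 * θ + θ / 5 - 1 / 2))))) ^ 2))) - 1) +
          6 * (β ^ (2 * (6 * θ))) ^ 2 * (240 * (D : ℝ) * (2 * (⌈β ^ θ⌉₊ : ℝ) + 1) ^ 4 * Real.exp (-(β ^ (6 * θ) / (4 * (Real.sqrt D + 1))) ^ 2 / 2)) +
          2 * (190 * β * (2 * ((12 * (⌈β ^ θ⌉₊ : ℝ) ^ 2 + 2 * (⌈β ^ θ⌉₊ : ℝ) + 1) * (Real.sqrt 2 * Real.sqrt (β ^ (2 * (6 * θ) - 1)) + 8 * (Ca * β ^ (3 * θ + θ / 5 - 1 / 2))))) ^ 3) * (β ^ (2 * (6 * θ)) + (2 * (D : ℝ) * ((Real.sqrt β * Real.sqrt (CE * (2 * (⌈β ^ θ⌉₊ : ℝ) + 3) ^ 4 * β ^ (2 * (θ / 5) - 1)) + 4 * (Real.sqrt β * (Ca * β ^ (3 * θ + θ / 5 - 1 / 2)))) ^ 2 + 2))) +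
          Real.sqrt (240 * (D : ℝ) * (2 * (⌈β ^ θ⌉₊ : ℝ) + 1) ^ 4 * Real.exp (-(β ^ (6 * θ) / (4 * (Real.sqrt D + 1))) ^ 2 / 2)) * (2 * β ^ (2 * (6 * θ)) * (2 * (D : ℝ) * ((Real.sqrt β * Real.sqrt (CE * (2 * (⌈β ^ θ⌉₊ : ℝ) + 3) ^ 4 * β ^ (2 * (θ / 5) - 1)) + 4 * (Real.sqrt β * (Ca * β ^ (3 * θ + θ / 5 - 1 / 2)))) ^ 2 + 2)) + (3 * (D : ℝ) ^ 2 * ((Real.sqrt β * Real.sqrt (CE * (2 * (⌈β ^ θ⌉₊ : ℝ) + 3) ^ 4 * β ^ (2 * (θ / 5) - 1)) + 4 * (Real.sqrt β * (Ca * β ^ (3 * θ + θ / 5 - 1 / 2)))) ^ 4 + 11)) + (2 * (D : ℝ) * ((Real.sqrt β * Real.sqrt (CE * (2 * (⌈β ^ θ⌉₊ : ℝ) + 3) ^ 4 * β ^ (2 * (θ / 5) - 1)) + 4 * (Real.sqrt β * (Ca * β ^ (3 * θ + θ / 5 - 1 / 2)))) ^ 2 + 2)) ^ 2)) ≤ β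 ^ (-(θ / 2)) ∧
      -- (5) the mean core's bound is ≤ β^(-θ)
      2 * (2 * N * β) * Real.exp (-(β ^ (6 * θ))) +
        (β ^ (2 * (6 * θ)) * (Real.exp (2 * (120 * (2 * (⌈β ^ θ⌉₊ : ℝ) + 1) ^ 4 * (190 * β * (2 * ((12 * (⌈β ^ θ⌉₊ : ℝ) ^ 2 + 2 * (⌈β ^ θ⌉₊ : ℝ) + 1) * (Real.sqrt 2 * Real.sqrt (β ^ (2 * (6 * θ) - 1)) + 8 * (Ca * β ^ (3 * θ + θ / 5 - 1 / 2))))) ^ 3) + 4 * (2 * (⌈β ^ θ⌉₊ : ℝ) + 1) ^ 4 * (2 * C₂ * (2 * ((12 * (⌈β ^ θ⌉₊ : ℝ) ^ 2 + 2 * (⌈β ^ θ⌉₊ : ℝ) + 1) * (Real.sqrt 2 * Real.sqrt (β ^ (2 * (6 * θ) - 1)) + 8 * (Ca * β ^ (3 * θ + θ / 5 - 1 / 2))))) ^ 2))) - 1) + (190 * β * (2 * ((12 * (⌈β ^ θ⌉₊ : ℝ) ^ 2 + 2 * (⌈β ^ θ⌉₊ : ℝ) + 1) * (Real.sqrt 2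 * Real.sqrt (β ^ (2 * (6 * θ) - 1)) + 8 * (Ca * β ^ (3 * θ + θ / 5 - 1 / 2))))) ^ 3) +
          2 * (1 + 2 * (D : ℝ) ^ 2 * ((Real.sqrt β * Real.sqrt (CE * (2 * (⌈β ^ θ⌉₊ : ℝ) + 3) ^ 4 * β ^ (2 * (θ / 5) - 1)) + 4 * (Real.sqrt β * (Ca * β ^ (3 * θ + θ / 5 - 1 / 2)))) ^ 4 + 3)) * Real.sqrt (240 * (D : ℝ) * (2 * (⌈β ^ θ⌉₊ : ℝ) + 1) ^ 4 * Real.exp (-(β ^ (6 * θ) / (4 * (Real.sqrt D + 1))) ^ 2 / 2))) ≤ β ^ (-θ) := by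
  sorry

end Summit.QuantumFields.YangMills.Theorems.ColdBoxAllGroups

end
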